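import Summits.SmoothPoincare4.SmoothPoincare4.Theorems.DottedCircleRasmussenDcrGapHelperFriendsCarrierTkAux3

/-!
# Helper `helper_friendsCarrier_Tk_trace` of stub `helper_friendsCarrier_Tk` — part 2: Hausdorffness and the two charts
(item stmt-SmoothPoincare4-16128, route route-SmoothPoincare4-DottedCircleRasmussen)

Continuation of part 1 (`…HelperFriendsCarrierTkAux3`: the gluing datum `FriendsTk.TraceDatum`, the
glued `4`-manifold `TraceDatum.Trace = P ∪_glue (ℝ² × ℝ²)`), following the tree's `OpenTrace.lean`
(`k = 0`) with the collar clock in place of the radial coordinate: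

* `TraceDatum.inl_eq_inr_iff`, `isClosed_graph`, `instT2SpaceTrace` — the identification of the two
  charts; the graph of the gluing map is closed (on it `G_k = 1 + δ(1 - ‖x‖)/(1 + ‖x‖) → 1 + δ` as
  `x → 0`, a value not taken on `P`), so the trace is Hausdorff (Kosinski 1993, VI §1);
* `TraceDatum.incl` — the `0`-handle chart `ℝ⁴ → T` (total; the germ `inl` along `P ⊇ D_k`), smooth,
  injective and immersive on `P`, open on `P`, with smooth inverse `TraceDatum.πl` on its image;
* `TraceDatum.πr` — the smooth inverse of the `2`-handle chart `inr : ℝ² × ℝ² → T`, which is a smooth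
  open immersion; `image_incl_union_range_inr`, `incl_eq_inr_iff`, `eq_incl_or_eq_inr_zero`;
* `helper_friendsCarrier_Tk_trace` — the registered summary: the GERM clauses of
  `helper_friendsCarrier_Tk` (`i` = `incl`, `U` = `P`) together with the two-chart interface the end
  collar is built from.

Everything is proved; the definitions are constructions, not named facts; no `sorry`.
References: Kosinski, *Differential Manifolds* (1993), VI §1 [Kosinski1993]; Kirby (1989), Ch. I §2 [Kirby1989];
Manolescu–Piccirillo (2023), §3.2 [ManolescuPiccirillo2023].
-/

-- the prescribed namespace `Summit.<P>.<Sub>.…` duplicates `SmoothPoincare4` (P = Sub)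
set_option linter.dupNamespace false
set_option linter.style.longLine false

noncomputable section

open scoped Manifold ContDiff Topology
open Function Set Metric
open Literature.Topology.FourManifolds Literature.Topology.FourManifolds.MMSW

namespace Summit.SmoothPoincare4.SmoothPoincare4.Theorems.DcrGap.MkFriends

namespace FriendsTk

/-- A continuous linear map with a left inverse is injective. [folklore] -/
theorem injective_of_comp_eq_id {R₁ M₁ M₂ : Type*} [Semiring R₁] [TopologicalSpace M₁] [AddCommMonoid M₁]
    [Module R₁ M₁] [TopologicalSpace M₂] [AddCommMonoid M₂] [Module R₁ M₂] {A : M₁ →L[R₁] M₂}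
    {B : M₂ →L[R₁] M₁} (h : B.comp A = ContinuousLinearMap.id R₁ M₁) : Injective A := by
  intro v w hvw
  have hv := DFunLike.congr_fun h v
  have hw := DFunLike.congr_fun h w
  simp only [ContinuousLinearMap.comp_apply, ContinuousLinearMap.id_apply] at hv hw
  rw [← hv, ← hw, hvw]

namespace TraceDatum

variable {k : ℕ} (D : TraceDatum k)

/-! ### Identification of the charts; Hausdorffness -/

/-- **The identification of the two charts**: `inl a = inr (x, w)` iff `x ≠ 0` and
`a = θ(δ(1 - ‖x‖)/(1 + ‖x‖), ν(x/‖x‖, w))`. [folklore] -/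
theorem inl_eq_inr_iff {a : D.hbOpens} {p : (EuclideanSpace ℝ (Fin 2)) × (EuclideanSpace ℝ (Fin 2))} :
    D.trGlueData.inl a = D.trGlueData.inr p ↔ p.1 ≠ 0 ∧ D.bwd p = a := by
  rw [SmoothGlueData.inl_eq_inr_iff, trGlueData_glue, trGlue_source, trGlue_apply, mem_preimage]
  constructor
  · rintro ⟨ha, rfl⟩
    exact ⟨D.fwd_fst_ne_zero ha, D.bwd_fwd ha⟩
  · rintro ⟨hp, hpa⟩
    refine ⟨by rw [← hpa]; exact D.bwd_mem_flowTube hp, by rw [← hpa]; exact D.fwd_bwd hp⟩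

/-- **The graph of the gluing map is closed** in `P × (ℝ² × ℝ²)`: it is the graph of `bwd` over
`x ≠ 0`, and it has no limit point over `x = 0` because on it
`G_k = 1 + δ(1 - ‖x‖)/(1 + ‖x‖) → 1 + δ`, a value not taken on `P` (Kosinski 1993, VI §1).
[cite: Kosinski1993, Ch. VI §1, proof of Thm. 1.1] -/
theorem isClosed_graph :
    IsClosed {q : D.hbOpens × ((EuclideanSpace ℝ (Fin 2)) × (EuclideanSpace ℝ (Fin 2))) | q.1 ∈ D.trGlue.source ∧ D.trGlue q.1 = q.2} := by
  have hG : {q : D.hbOpens × ((EuclideanSpace ℝ (Fin 2)) × (EuclideanSpace ℝ (Fin 2))) | q.1 ∈ D.trGlue.source ∧ D.trGlue q.1 = q.2} =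
      {q | q.2.1 ≠ 0 ∧ D.bwd q.2 = q.1} := by
    ext ⟨a, p⟩
    exact D.inl_eq_inr_iff.symm.trans (SmoothGlueData.inl_eq_inr_iff _) |>.symm
  rw [hG, isClosed_iff_nhds]
  rintro ⟨a, p⟩ H
  by_cases hp : p.1 ≠ 0
  · refine ⟨hp, ?_⟩
    by_contra hne
    obtain ⟨W₁, W₂, hW₁, hW₂, h₁, h₂, hW⟩ := t2_separation hne
    have ho : IsOpen {p : (EuclideanSpace ℝ (Fin 2)) × (EuclideanSpace ℝ (Fin 2)) | p.1 ≠ 0} := isOpen_ne.preimage continuous_fst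
    have hUo : IsOpen ({p : (EuclideanSpace ℝ (Fin 2)) × (EuclideanSpace ℝ (Fin 2)) | p.1 ≠ 0} ∩ D.bwd ⁻¹' W₁) :=
      D.contMDiffOn_bwd.continuousOn.isOpen_inter_preimage ho hW₁
    obtain ⟨⟨a', p'⟩, ⟨ha'W, hp'U⟩, -, hq⟩ := H ((Subtype.val ⁻¹' W₂) ×ˢ ({p : (EuclideanSpace ℝ (Fin 2)) × (EuclideanSpace ℝ (Fin 2)) | p.1 ≠ 0} ∩ D.bwd ⁻¹' W₁))
      (prod_mem_nhds ((hW₂.preimage continuous_subtype_val).mem_nhds h₂) (hUo.mem_nhds ⟨hp, h₁⟩))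
    dsimp only at hq ha'W hp'U
    have : (a' : (EuclideanSpace ℝ (Fin 4))) ∈ W₂ := ha'W
    rw [← hq] at this
    exact Set.disjoint_left.1 hW hp'U.2 this
  · exfalso
    rw [not_not] at hp
    have hcont : ContinuousAt (fun a' : D.hbOpens => levelFun k (a' : (EuclideanSpace ℝ (Fin 4)))) a :=
      (contDiffAt_levelFun fun j => (lt_trans (by norm_num) (a.2.1 j)).ne').continuousAt.comp
        continuous_subtype_val.continuousAt
    set ε : ℝ := (1 + D.δ - levelFun k (a : (EuclideanSpace ℝ (Fin 4)))) / 2 with hε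
    have hεpos : 0 < ε := by have := a.2.2; rw [hε]; linarith
    have hTcont : Continuous fun p' : (EuclideanSpace ℝ (Fin 2)) × (EuclideanSpace ℝ (Fin 2)) => D.collarTime ‖p'.1‖ := by
      simp only [collarTime]
      exact (continuous_const.mul (continuous_const.sub (continuous_norm.comp continuous_fst))).div
        (continuous_const.add (continuous_norm.comp continuous_fst)) fun p' => by positivity
    have hU : {a' : D.hbOpens | levelFun k (a' : (EuclideanSpace ℝ (Fin 4))) < levelFun k (a : (EuclideanSpace ℝ (Fin 4))) + ε} ×ˢ
        {p' : (EuclideanSpace ℝ (Fin 2)) × (EuclideanSpace ℝ (Fin 2)) | D.δ - ε < D.collarTime ‖p'.1‖} ∈ 𝓝 (a, p) := by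
      refine prod_mem_nhds ((isOpen_lt (continuous_iff_continuousAt.2 fun a' =>
        (contDiffAt_levelFun fun j => (lt_trans (by norm_num) (a'.2.1 j)).ne').continuousAt.comp
          continuous_subtype_val.continuousAt) continuous_const).mem_nhds (by simp [hεpos]))
        ((isOpen_lt continuous_const hTcont).mem_nhds ?_)
      show D.δ - ε < D.collarTime ‖p.1‖
      rw [hp, norm_zero, collarTime]; simp; linarith
    obtain ⟨⟨a', p'⟩, ⟨ha', hp'⟩, hp'0, hq⟩ := H _ hU
    dsimp only at hq ha' hp' hp'0
    simp only [mem_setOf_eq] at ha' hp'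
    have h1 : levelFun k (D.bwd p') = 1 + D.collarTime ‖p'.1‖ := D.levelFun_bwd hp'0
    rw [hq] at h1
    rw [hε] at ha' hp'
    linarith

/-- **The relative open trace is Hausdorff.** [cite: Kosinski1993, Ch. VI §1, proof of Thm. 1.1] -/
instance instT2SpaceTrace : T2Space D.Trace :=
  D.trGlueData.t2Space_of_isClosed_graph D.isClosed_graph

/-- A point of the `2`-handle chart lies in the `0`-handle chart iff it is off the cocore plane.
[folklore] -/
theorem inr_mem_range_inl_iff {p : (EuclideanSpace ℝ (Fin 2)) × (EuclideanSpace ℝ (Fin 2))} :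
    D.trGlueData.inr p ∈ range D.trGlueData.inl ↔ p.1 ≠ 0 := by
  rw [SmoothGlueData.inr_mem_range_inl_iff, trGlueData_glue, trGlue_target, mem_setOf_eq]


/-! ### The `0`-handle chart `incl : ℝ⁴ → T` and its inverse `πl` -/

/-- `P` is nonempty (it contains the knot). [folklore] -/
instance instNonemptyNbhdOpens : Nonempty D.hbOpens := ⟨D.basePt⟩

/-- **The `0`-handle chart** made total on `ℝ⁴`: `incl y = inl y` for `y ∈ P` (junk off `P`); the
germ chart `i` of `helper_friendsCarrier_Tk` along `D_k ⊆ P`. [folklore] -/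
def incl (y : (EuclideanSpace ℝ (Fin 4))) : D.Trace := D.trGlueData.inl (TubeNbhd.toOpens' D.hbOpens D.basePt y)

/-- `incl = inl` on `P`. [folklore] -/
theorem incl_of_mem {y : (EuclideanSpace ℝ (Fin 4))} (hy : y ∈ D.hbNbhd) : D.incl y = D.trGlueData.inl ⟨y, hy⟩ := by
  rw [incl, TubeNbhd.toOpens'_of_mem _ hy]

/-- `incl a = inl a` for `a : P`. [folklore] -/
theorem incl_coe (a : D.hbOpens) : D.incl a = D.trGlueData.inl a := D.incl_of_mem a.2

/-- `incl '' P = range inl`. [folklore] -/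
theorem image_incl_hbNbhd : D.incl '' D.hbNbhd = range D.trGlueData.inl := by
  ext z
  constructor
  · rintro ⟨y, hy, rfl⟩; exact ⟨⟨y, hy⟩, (D.incl_of_mem hy).symm⟩
  · rintro ⟨a, rfl⟩; exact ⟨a, a.2, D.incl_coe a⟩

/-- `incl` is smooth on `P`. [folklore] -/
theorem contMDiffOn_incl : ContMDiffOn (𝓡 4) (𝓡 4) ∞ D.incl D.hbNbhd :=
  D.trGlueData.contMDiff_inl.comp_contMDiffOn (TubeNbhd.contMDiffOn_toOpens' (I := 𝓘(ℝ, (EuclideanSpace ℝ (Fin 4)))) D.hbOpens D.basePt)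

/-- `incl` is injective on `P`. [folklore] -/
theorem injOn_incl : InjOn D.incl D.hbNbhd := fun y hy y' hy' h => by
  rw [D.incl_of_mem hy, D.incl_of_mem hy'] at h
  exact congrArg Subtype.val (D.trGlueData.inl_injective h)

/-- `incl` is open on `P`. [folklore] -/
theorem isOpen_image_incl {V : Set (EuclideanSpace ℝ (Fin 4))} (hVP : V ⊆ D.hbNbhd) (hV : IsOpen V) : IsOpen (D.incl '' V) := by
  have : D.incl '' V = D.trGlueData.inl '' (Subtype.val ⁻¹' V) := by
    ext z
    constructor
    · rintro ⟨y, hy, rfl⟩; exact ⟨⟨y, hVP hy⟩, hy, (D.incl_of_mem _).symm⟩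
    · rintro ⟨a, ha, rfl⟩; exact ⟨a, ha, D.incl_coe a⟩
  rw [this]
  exact D.trGlueData.isOpenMap_inl _ (hV.preimage continuous_subtype_val)

/-- **The inverse of the `0`-handle chart** (junk off `range inl`). [folklore] -/
def πl (z : D.Trace) : (EuclideanSpace ℝ (Fin 4)) := ((Function.invFun D.trGlueData.inl z : D.hbOpens) : (EuclideanSpace ℝ (Fin 4)))

/-- `πl (inl a) = a`. [folklore] -/
theorem πl_inl (a : D.hbOpens) : D.πl (D.trGlueData.inl a) = a := by
  rw [πl, Function.leftInverse_invFun D.trGlueData.inl_injective a]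

/-- `πl (incl y) = y` on `P`. [folklore] -/
theorem πl_incl {y : (EuclideanSpace ℝ (Fin 4))} (hy : y ∈ D.hbNbhd) : D.πl (D.incl y) = y := by
  rw [D.incl_of_mem hy, πl_inl]

/-- `πl` is smooth on `range inl`. [folklore] -/
theorem contMDiffOn_πl : ContMDiffOn (𝓡 4) (𝓡 4) ∞ D.πl (range D.trGlueData.inl) := by
  have h := contMDiffOn_symm_of_isSmoothEmbedding D.trGlueData.isSmoothEmbedding_inl D.trGlueData.isOpenEmbedding_inl
  have h' : ContMDiffOn (𝓡 4) (𝓡 4) ∞ (Function.invFun D.trGlueData.inl) (range D.trGlueData.inl) := by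
    refine h.congr ?_
    rintro _ ⟨a, rfl⟩
    rw [Function.leftInverse_invFun D.trGlueData.inl_injective a]
    exact (D.trGlueData.isOpenEmbedding_inl.toOpenPartialHomeomorph_left_inv (x := a)).symm
  exact contMDiff_subtype_val.comp_contMDiffOn h'

/-- The `0`-handle chart `inl` is an immersion. [folklore] -/
theorem injective_mfderiv_inl (a : D.hbOpens) : Injective (mfderiv (𝓡 4) (𝓡 4) D.trGlueData.inl a) := by
  obtain ⟨F, _, _, hF⟩ := D.trGlueData.isSmoothEmbedding_inl.isImmersion
  exact Manifold.IsImmersionAtOfComplement.mfderiv_injective (hF a) (by simp)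

/-- **`incl` is an immersion on `P`.** [folklore] -/
theorem injective_mfderiv_incl {y : (EuclideanSpace ℝ (Fin 4))} (hy : y ∈ D.hbNbhd) : Injective (mfderiv (𝓡 4) (𝓡 4) D.incl y) := by
  have hn : (∞ : ℕ∞ω) ≠ 0 := by simp
  set T := TubeNbhd.toOpens' D.hbOpens D.basePt with hT
  have hTd : MDifferentiableAt (𝓡 4) (𝓡 4) T y :=
    ((TubeNbhd.contMDiffOn_toOpens' (I := 𝓘(ℝ, (EuclideanSpace ℝ (Fin 4)))) D.hbOpens D.basePt).contMDiffAt
      (D.isOpen_hbNbhd.mem_nhds hy)).mdifferentiableAt hn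
  have hinl : MDifferentiableAt (𝓡 4) (𝓡 4) D.trGlueData.inl (T y) := D.trGlueData.contMDiff_inl.mdifferentiableAt hn
  have hcomp : mfderiv (𝓡 4) (𝓡 4) D.incl y =
      (mfderiv (𝓡 4) (𝓡 4) D.trGlueData.inl (T y)).comp (mfderiv (𝓡 4) (𝓡 4) T y) := by
    have : D.incl = D.trGlueData.inl ∘ T := rfl
    rw [this, mfderiv_comp y hinl hTd]
  have hev : (Subtype.val ∘ T) =ᶠ[𝓝 y] id := by
    filter_upwards [D.isOpen_hbNbhd.mem_nhds hy] with y' hy'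
    simp only [comp_apply, hT, TubeNbhd.toOpens'_of_mem D.basePt hy', id_eq]
  have hval : MDifferentiableAt (𝓡 4) (𝓡 4) (Subtype.val : D.hbOpens → (EuclideanSpace ℝ (Fin 4))) (T y) :=
    contMDiff_subtype_val.mdifferentiableAt hn
  have hid : (mfderiv (𝓡 4) (𝓡 4) (Subtype.val : D.hbOpens → (EuclideanSpace ℝ (Fin 4))) (T y)).comp (mfderiv (𝓡 4) (𝓡 4) T y) =
      ContinuousLinearMap.id ℝ _ := by
    rw [← mfderiv_comp y hval hTd, hev.mfderiv_eq, mfderiv_id]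
  rw [hcomp]
  exact (D.injective_mfderiv_inl (T y)).comp (injective_of_comp_eq_id hid)

/-! ### The `2`-handle chart `inr` and its inverse `πr` -/

/-- **The inverse of the `2`-handle chart** (junk off `range inr`). [folklore] -/
def πr (z : D.Trace) : (EuclideanSpace ℝ (Fin 2)) × (EuclideanSpace ℝ (Fin 2)) := Function.invFun D.trGlueData.inr z

/-- `πr (inr p) = p`. [folklore] -/
theorem πr_inr (p : (EuclideanSpace ℝ (Fin 2)) × (EuclideanSpace ℝ (Fin 2))) : D.πr (D.trGlueData.inr p) = p :=
  Function.leftInverse_invFun D.trGlueData.inr_injective p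

/-- `πr` is smooth on `range inr`. [folklore] -/
theorem contMDiffOn_πr : ContMDiffOn (𝓡 4) 𝓘(ℝ, (EuclideanSpace ℝ (Fin 2)) × (EuclideanSpace ℝ (Fin 2))) ∞ D.πr (range D.trGlueData.inr) := by
  have h := contMDiffOn_symm_of_isSmoothEmbedding D.trGlueData.isSmoothEmbedding_inr D.trGlueData.isOpenEmbedding_inr
  refine h.congr ?_
  rintro _ ⟨p, rfl⟩
  rw [πr_inr]
  exact (D.trGlueData.isOpenEmbedding_inr.toOpenPartialHomeomorph_left_inv (x := p)).symm

/-- The `2`-handle chart is an immersion. [folklore] -/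
theorem injective_mfderiv_inr (p : (EuclideanSpace ℝ (Fin 2)) × (EuclideanSpace ℝ (Fin 2))) :
    Injective (mfderiv 𝓘(ℝ, (EuclideanSpace ℝ (Fin 2)) × (EuclideanSpace ℝ (Fin 2))) (𝓡 4) D.trGlueData.inr p) := by
  obtain ⟨F, _, _, hF⟩ := D.trGlueData.isSmoothEmbedding_inr.isImmersion
  exact Manifold.IsImmersionAtOfComplement.mfderiv_injective (hF p) (by simp)

/-! ### The two charts together -/

/-- The two charts cover the trace. [folklore] -/
theorem image_incl_union_range_inr : D.incl '' D.hbNbhd ∪ range D.trGlueData.inr = univ := by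
  rw [D.image_incl_hbNbhd]; exact D.trGlueData.range_inl_union_range_inr

/-- `incl y = inr (x, w)` iff `x ≠ 0` and `y = bwd (x, w)`. [folklore] -/
theorem incl_eq_inr_iff {y : (EuclideanSpace ℝ (Fin 4))} (hy : y ∈ D.hbNbhd) {p : (EuclideanSpace ℝ (Fin 2)) × (EuclideanSpace ℝ (Fin 2))} :
    D.incl y = D.trGlueData.inr p ↔ p.1 ≠ 0 ∧ D.bwd p = y := by
  rw [D.incl_of_mem hy, D.inl_eq_inr_iff]

/-- A point of the `2`-handle chart lies in `incl '' P` iff it is off the cocore plane. [folklore] -/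
theorem inr_mem_image_incl_iff {p : (EuclideanSpace ℝ (Fin 2)) × (EuclideanSpace ℝ (Fin 2))} : D.trGlueData.inr p ∈ D.incl '' D.hbNbhd ↔ p.1 ≠ 0 := by
  rw [D.image_incl_hbNbhd, D.inr_mem_range_inl_iff]

/-- The backward map lands in `P`. [folklore] -/
theorem bwd_mem_hbNbhd {p : (EuclideanSpace ℝ (Fin 2)) × (EuclideanSpace ℝ (Fin 2))} (hp : p.1 ≠ 0) : D.bwd p ∈ D.hbNbhd :=
  D.flowTube_subset_hbNbhd (D.bwd_mem_flowTube hp)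

/-- Off the cocore plane, `inr p = incl (bwd p)`. [folklore] -/
theorem inr_eq_incl_bwd {p : (EuclideanSpace ℝ (Fin 2)) × (EuclideanSpace ℝ (Fin 2))} (hp : p.1 ≠ 0) : D.trGlueData.inr p = D.incl (D.bwd p) :=
  ((D.incl_eq_inr_iff (D.bwd_mem_hbNbhd hp)).2 ⟨hp, rfl⟩).symm

/-- Every point of the trace lies in the `0`-handle chart or on the cocore plane `inr({0} × ℝ²)`.
[folklore] -/
theorem eq_incl_or_eq_inr_zero (z : D.Trace) :
    (∃ y ∈ D.hbNbhd, D.incl y = z) ∨ ∃ w, D.trGlueData.inr (0, w) = z := by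
  obtain (⟨a, rfl⟩ | ⟨⟨x, w⟩, rfl⟩) := D.trGlueData.exists_inl_or_inr z
  · exact Or.inl ⟨a, a.2, D.incl_coe a⟩
  · by_cases hx : x = 0
    · subst hx; exact Or.inr ⟨w, rfl⟩
    · exact Or.inl ⟨_, D.bwd_mem_hbNbhd (p := (x, w)) hx, (D.inr_eq_incl_bwd (p := (x, w)) hx).symm⟩

end TraceDatum

end FriendsTk

/-- **Helper `helper_friendsCarrier_Tk_trace`** (registered on the crux item; piece (3b) of the
relative open trace `T_k` of stub `helper_friendsCarrier_Tk`): from the collar flow (piece (1)) and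
the tube coordinates (piece (2)) of a tube `ν : 𝕊¹ × ℝ² → M_k`, the relative open trace
`T = P ∪_glue (ℝ² × ℝ²)` is a Hausdorff `C^∞` `4`-manifold charted on `ℝ⁴` with: the GERM clauses of
`helper_friendsCarrier_Tk` for the `0`-handle chart `i` along the open `P = {G_k < 1 + δ} ⊇ D_k`
(smooth, injective, immersive), `i` open on `P` with smooth inverse `πl`; the `2`-handle chart `h`
a smooth open immersion with smooth inverse `πr`; the two charts cover `T` and are identified
exactly along `x ≠ 0` by `h (x, w) = i (θ(δ(1 - ‖x‖)/(1 + ‖x‖), ν(x/‖x‖, w)))` (Kirby 1989, Ch. I §2;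
Manolescu–Piccirillo Def. 3.4 with `B⁴` replaced by `D_k`). [cite: Kirby1989, Ch. I §2] -/
theorem helper_friendsCarrier_Tk_trace : ∀ (k : ℕ) (νK : (sphere (0 : EuclideanSpace ℝ (Fin 2)) 1) × EuclideanSpace ℝ (Fin 2) → EuclideanSpace ℝ (Fin 4)) (θ : ℝ × EuclideanSpace ℝ (Fin 4) → EuclideanSpace ℝ (Fin 4)) (δ : ℝ) (ι : EuclideanSpace ℝ (Fin 4) → (sphere (0 : EuclideanSpace ℝ (Fin 2)) 1) × EuclideanSpace ℝ (Fin 2)), 0 < δ → δ < 1 → ContDiff ℝ ((⊤ : ℕ∞) : WithTop ℕ∞) θ → (∀ x, θ (0, x) = x) → (∀ t s x, θ (t, θ (s, x)) = θ (t + s, x)) → (∀ y : EuclideanSpace ℝ (Fin 4), (∀ j, (1 : ℝ) / 2 < holeTerm k j y) → levelFun k y ∈ Ioo (1 - δ) (1 + δ) → ∀ t : ℝ, levelFun k y + t ∈ Ioo (1 - δ) (1 + δ) → (∀ j, (1 : ℝ) / 2 < holeTerm k j (θ (t, y))) ∧ levelFun k (θ (t, y)) = levelFun k y + t) → (∀ a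 ∈ modelBoundary k, ∀ s ∈ Ioo (-δ) δ, (θ (s, a) ∈ modelHandlebody k ↔ s ≤ 0)) → ContMDiff ((𝓡 1).prod 𝓘(ℝ, EuclideanSpace ℝ (Fin 2))) 𝓘(ℝ, EuclideanSpace ℝ (Fin 4)) ((⊤ : ℕ∞) : WithTop ℕ∞) νK → (∀ p, νK p ∈ modelBoundary k) → IsOpen {y : EuclideanSpace ℝ (Fin 4) | (∀ j, (1 : ℝ) / 2 < holeTerm k j y) ∧ levelFun k y ∈ Ioo (1 - δ) (1 + δ) ∧ θ (1 - levelFun k y, y) ∈ range νK} → ContMDiffOn 𝓘(ℝ, EuclideanSpace ℝ (Fin 4)) ((𝓡 1).prod 𝓘(ℝ, EuclideanSpace ℝ (Fin 2))) ((⊤ : ℕ∞) : WithTop ℕ∞) ι {y : EuclideanSpace ℝ (Fin 4) | (∀ j, (1 : ℝ) / 2 < holeTerm k j y) ∧ levelFun k y ∈ Ioo (1 - δ) (1 + δ) ∧ θ (1 - levelFun k y, y) ∈ range νK} → (∀ (q : (sphere (0 : EuclideanSpace ℝ (Fin 2)) 1) × EuclideanSpace ℝ (Fin 2)) (s : ℝ),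 s ∈ Ioo (-δ) δ → ι (θ (s, νK q)) = q) → (∀ y ∈ {y : EuclideanSpace ℝ (Fin 4) | (∀ j, (1 : ℝ) / 2 < holeTerm k j y) ∧ levelFun k y ∈ Ioo (1 - δ) (1 + δ) ∧ θ (1 - levelFun k y, y) ∈ range νK}, θ (levelFun k y - 1, νK (ι y)) = y) → ∃ (X : Type) (_ : TopologicalSpace X) (_ : T2Space X) (_ : ChartedSpace (EuclideanSpace ℝ (Fin 4)) X) (_ : IsManifold (𝓡 4) ((⊤ : ℕ∞) : WithTop ℕ∞) X) (i : EuclideanSpace ℝ (Fin 4) → X) (h : EuclideanSpace ℝ (Fin 2) × EuclideanSpace ℝ (Fin 2) → X) (πl : X → EuclideanSpace ℝ (Fin 4)) (πr : X → EuclideanSpace ℝ (Fin 2) × EuclideanSpace ℝ (Fin 2)), (IsOpen {y : EuclideanSpace ℝ (Fin 4) | (∀ j, (1 : ℝ) / 2 < holeTerm k j y) ∧ levelFun k y < 1 + δ} ∧ modelHandlebody k ⊆ {y : EuclideanSpace ℝ (Fin 4) | (∀ j, (1 : ℝ) / 2 < holeTerm k j y) ∧ levelFun k y < 1 + δ} ∧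 ContMDiffOn (𝓡 4) (𝓡 4) ((⊤ : ℕ∞) : WithTop ℕ∞) i {y : EuclideanSpace ℝ (Fin 4) | (∀ j, (1 : ℝ) / 2 < holeTerm k j y) ∧ levelFun k y < 1 + δ} ∧ InjOn i {y : EuclideanSpace ℝ (Fin 4) | (∀ j, (1 : ℝ) / 2 < holeTerm k j y) ∧ levelFun k y < 1 + δ} ∧ (∀ x ∈ {y : EuclideanSpace ℝ (Fin 4) | (∀ j, (1 : ℝ) / 2 < holeTerm k j y) ∧ levelFun k y < 1 + δ}, Injective (mfderiv (𝓡 4) (𝓡 4) i x))) ∧ (∀ V ⊆ {y : EuclideanSpace ℝ (Fin 4) | (∀ j, (1 : ℝ) / 2 < holeTerm k j y) ∧ levelFun k y < 1 + δ}, IsOpen V → IsOpen (i '' V)) ∧ ContMDiffOn (𝓡 4) (𝓡 4) ((⊤ : ℕ∞) : WithTop ℕ∞) πl (i '' {y : EuclideanSpace ℝ (Fin 4) | (∀ j, (1 : ℝ) / 2 < holeTerm k j y) ∧ levelFun k y < 1 + δ}) ∧ (∀ y ∈ {y : EuclideanSpace ℝ (Fin 4) | (∀ j, (1 : ℝ)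 / 2 < holeTerm k j y) ∧ levelFun k y < 1 + δ}, πl (i y) = y) ∧ ContMDiff 𝓘(ℝ, EuclideanSpace ℝ (Fin 2) × EuclideanSpace ℝ (Fin 2)) (𝓡 4) ((⊤ : ℕ∞) : WithTop ℕ∞) h ∧ IsOpenMap h ∧ (∀ p, Injective (mfderiv 𝓘(ℝ, EuclideanSpace ℝ (Fin 2) × EuclideanSpace ℝ (Fin 2)) (𝓡 4) h p)) ∧ ContMDiffOn (𝓡 4) 𝓘(ℝ, EuclideanSpace ℝ (Fin 2) × EuclideanSpace ℝ (Fin 2)) ((⊤ : ℕ∞) : WithTop ℕ∞) πr (range h) ∧ (∀ p, πr (h p) = p) ∧ i '' {y : EuclideanSpace ℝ (Fin 4) | (∀ j, (1 : ℝ) / 2 < holeTerm k j y) ∧ levelFun k y < 1 + δ} ∪ range h = univ ∧ (∀ y ∈ {y : EuclideanSpace ℝ (Fin 4) | (∀ j, (1 : ℝ) / 2 < holeTerm k j y) ∧ levelFun k y < 1 + δ}, ∀ p : EuclideanSpace ℝ (Fin 2) × EuclideanSpace ℝ (Fin 2), i y = h p ↔ p.1 ≠ 0 ∧ θ (δ *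 (1 - ‖p.1‖) / (1 + ‖p.1‖), νK (radialProjection (spherePt 1) p.1, p.2)) = y) ∧ (∀ p : EuclideanSpace ℝ (Fin 2) × EuclideanSpace ℝ (Fin 2), p.1 ≠ 0 → θ (δ * (1 - ‖p.1‖) / (1 + ‖p.1‖), νK (radialProjection (spherePt 1) p.1, p.2)) ∈ {y : EuclideanSpace ℝ (Fin 4) | (∀ j, (1 : ℝ) / 2 < holeTerm k j y) ∧ levelFun k y < 1 + δ}) := by
  intro k νK θ δ ι hδ hδ1 hθ h0 hadd hclock hiff hν hmem hopen hι hιθ hθι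
  let D : FriendsTk.TraceDatum k := ⟨νK, θ, δ, ι, hδ, hδ1, hθ, h0, hadd, hclock, hiff, hν, hmem, hopen, hι, hιθ, hθι⟩
  refine ⟨D.Trace, inferInstance, inferInstance, inferInstance, inferInstance, D.incl, D.trGlueData.inr, D.πl, D.πr,
    ⟨D.isOpen_hbNbhd, D.modelHandlebody_subset_hbNbhd, D.contMDiffOn_incl, D.injOn_incl,
      fun x hx => D.injective_mfderiv_incl hx⟩,
    fun V hV hVo => D.isOpen_image_incl hV hVo, ?_, fun y hy => D.πl_incl hy, D.trGlueData.contMDiff_inr,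
    D.trGlueData.isOpenMap_inr, D.injective_mfderiv_inr, D.contMDiffOn_πr, D.πr_inr, D.image_incl_union_range_inr,
    fun y hy p => D.incl_eq_inr_iff hy, fun p hp => D.bwd_mem_hbNbhd hp⟩
  show ContMDiffOn (𝓡 4) (𝓡 4) ∞ D.πl (D.incl '' D.hbNbhd)
  rw [D.image_incl_hbNbhd]
  exact D.contMDiffOn_πl

end Summit.SmoothPoincare4.SmoothPoincare4.Theorems.DcrGap.MkFriends

end
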